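/-
Copyright (c) 2026 the pub-hodgecm-mathlib formalisation cell (harness21).  Prover seat hodgecm-mathlib-K2E5-p16 (g6), Track B «K2-LIT»,
#184♮ = hLiu418 = `stmt-HodgeConjecture-24832`; row `K2LiuArchIntertwiningLieEquivariance`, file (A) `K2LiuArchIntertwiningLieDerivative`,
PART 3 (instances): the swap lemma and its closed form along the one-parameter curve `exp (tW)` and the affine curve `1 + tW`.
THEOREMS ONLY (no `def`, no `instance`, no notation, no named-fact hypothesis, no `sorry`; no matrix norm in any statement).
-/
import Summits.HodgeConjecture.HodgeConjecture.Theorems.K2LiuArchIntertwiningLieDerivative   -- ★ (this seat) (A) part 2: the swap lemma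
import HarnessLib

/-!
# Crux `HLiu418`, A∞ organ, (A) part 3: the swap lemma along `exp (tW)` and `1 + tW`

Cell `hodgecm-mathlib`, crux item hLiu418 = `stmt-HodgeConjecture-24832` (helper lane `--supports`, count-neutral).

★ part 2 `hasDerivAt_archIntertwining_archScalarSection_mul_curve` ∕ `archIntertwining_lieDeriv_archScalarSection_eq` take an arbitrary
entrywise-`C¹` curve `γ` through `1`.  Here the two curves of record: `γ_t = exp (tW)` (★ H1-E; for `W ∈ 𝔲(J)` it stays in `U(J)` and the
closed form `M_w(s)(D_W f⁰_{s,k})(g) = c_k(s)·(D_W f⁰_{−s,k})(g)` follows — `archIntertwining_lieDeriv_archScalarSection_exp_eq`, the letter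
consumed by K2Liu-p11 (g2)'s (C2) `K2LiuArchPMinusIntertwiningKernel`) and `γ_t = 1 + tW` (the ambient convention; any `W ∈ M₄(ℂ)`).
References: [Knapp1986, Ch. I §1, Ch. VII §§3–4]; [Shimura1997, §16.4].
HONEST LABEL: HC_CM is proved only modulo the 7 printed citations (2 remaining named inputs: hLiu418 = stmt-HodgeConjecture-24832,
h413 = stmt-HodgeConjecture-24833) until rung 0 closes; count-neutral helper, closes no socket.
-/

set_option autoImplicit false
set_option linter.dupNamespace false

noncomputable section

open Complex Matrix MeasureTheory Filter NormedSpace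
open scoped ComplexConjugate ComplexOrder Topology

namespace Summit.HodgeConjecture.HodgeConjecture.Cruxes.HLiu418.K2LiuArchIntertwiningLieDerivativeExp

open Literature.NumberTheory.ModularForms.SiegelUpperHalfSpace (num denom moeb num_def denom_def moeb_def)
open Summit.HodgeConjecture.HodgeConjecture.Cruxes.HLiu418.K2LiuArchInducedTubeDefs
open Summit.HodgeConjecture.HodgeConjecture.Cruxes.HLiu418.K2LiuArchScalarSectionCurveDerivative (exp_zero_smul_eq_one)
open Summit.HodgeConjecture.HodgeConjecture.Cruxes.HLiu418.K2LiuArchNormalisingScalar (archScalarCoeff)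
open Summit.HodgeConjecture.HodgeConjecture.Cruxes.HLiu418.K2LiuArchIntertwiningLieDerivative

/-! ## §1  The one-parameter curve `exp (tW)` and the affine curve `1 + tW` -/

/-- Entries of `t ↦ exp (tW)` are differentiable EVERYWHERE with derivative `(W · exp (tW))ᵢⱼ`. [Knapp1986, Ch. I §1] -/
theorem hasDerivAt_exp_smul_entry_at (W : Matrix (Fin 2 ⊕ Fin 2) (Fin 2 ⊕ Fin 2) ℂ) (t : ℝ) (i j : Fin 2 ⊕ Fin 2) :
    HasDerivAt (fun t : ℝ => exp (t • W) i j) ((W * exp (t • W)) i j) t := by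
  open scoped Matrix.Norms.Operator in
  have he : HasDerivAt (fun t : ℝ => exp (t • W)) (W * exp (t • W)) t := hasDerivAt_exp_smul_const' (𝕂 := ℝ) W t
  exact (Matrix.entryLinearMap ℝ ℂ i j).toContinuousLinearMap.hasFDerivAt.comp_hasDerivAt t he

/-- Entries of `t ↦ W · exp (tW)` are continuous. [Knapp1986, Ch. I §1] -/
theorem continuous_mul_exp_smul_entry (W : Matrix (Fin 2 ⊕ Fin 2) (Fin 2 ⊕ Fin 2) ℂ) (i j : Fin 2 ⊕ Fin 2) :
    Continuous fun t : ℝ => (W * exp (t • W)) i j := by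
  have hc : Continuous fun t : ℝ => exp (t • W) :=
    continuous_of_entry_hasDerivAt (γ' := fun t => W * exp (t • W)) (hasDerivAt_exp_smul_entry_at W)
  exact (continuous_const.matrix_mul hc).matrix_elem i j

/-- **THE SWAP LEMMA ALONG `exp (tW)`** (any `W ∈ M₄(ℂ)`; for `W ∈ 𝔲(J)` this is `D_W (M_w f⁰_{s,k}) = M_w (D_W f⁰_{s,k})`).
[Knapp1986, Ch. VII §3] -/
theorem hasDerivAt_archIntertwining_archScalarSection_mul_exp (k : ℤ) {s : ℂ} (hs : 1 / 2 < s.re)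
    {g : Matrix (Fin 2 ⊕ Fin 2) (Fin 2 ⊕ Fin 2) ℂ} (hg : gᴴ * Matrix.J (Fin 2) ℂ * g = Matrix.J (Fin 2) ℂ)
    (W : Matrix (Fin 2 ⊕ Fin 2) (Fin 2 ⊕ Fin 2) ℂ) :
    HasDerivAt (fun t : ℝ => archIntertwining (archScalarSection k s) (g * exp (t • W)))
      (archIntertwining (fun y => archScalarSection k s y *
          ((((k : ℂ) - 2 * s - 2) / 2 - k) *
              ((denom y (I • (1 : Matrix (Fin 2) (Fin 2) ℂ)))⁻¹ * denom (y * W) (I • (1 : Matrix (Fin 2) (Fin 2) ℂ))).trace +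
            ((k : ℂ) - 2 * s - 2) / 2 *
              conj ((denom y (I • (1 : Matrix (Fin 2) (Fin 2) ℂ)))⁻¹ * denom (y * W) (I • (1 : Matrix (Fin 2) (Fin 2) ℂ))).trace)) g) 0 := by
  have h := hasDerivAt_archIntertwining_archScalarSection_mul_curve k hs hg (γ := fun t : ℝ => exp (t • W))
    (γ' := fun t : ℝ => W * exp (t • W)) (exp_zero_smul_eq_one W) (hasDerivAt_exp_smul_entry_at W)
    (fun i j => (continuous_mul_exp_smul_entry W i j).continuousAt)
  simpa only [exp_zero_smul_eq_one, Matrix.mul_one] using h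

/-- **THE CLOSED FORM ALONG `exp (tW)` FOR `W` TANGENT TO `U(J)`** (`exp (tW) ∈ U(J)` for all `t`):
`M_w(s)(D_W f⁰_{s,k})(g) = c_k(s)·(D_W f⁰_{−s,k})(g)`, `re s > ½`, `g ∈ U(2,2)`. [Knapp1986, Ch. VII §§3–4; Shimura1997, §16.4] -/
theorem archIntertwining_lieDeriv_archScalarSection_exp_eq (k : ℤ) {s : ℂ} (hs : 1 / 2 < s.re)
    {g : Matrix (Fin 2 ⊕ Fin 2) (Fin 2 ⊕ Fin 2) ℂ} (hg : gᴴ * Matrix.J (Fin 2) ℂ * g = Matrix.J (Fin 2) ℂ)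
    {W : Matrix (Fin 2 ⊕ Fin 2) (Fin 2 ⊕ Fin 2) ℂ} (hW : ∀ t : ℝ, (exp (t • W))ᴴ * Matrix.J (Fin 2) ℂ * exp (t • W) = Matrix.J (Fin 2) ℂ) :
    archIntertwining (fun y => archScalarSection k s y *
          ((((k : ℂ) - 2 * s - 2) / 2 - k) *
              ((denom y (I • (1 : Matrix (Fin 2) (Fin 2) ℂ)))⁻¹ * denom (y * W) (I • (1 : Matrix (Fin 2) (Fin 2) ℂ))).trace +
            ((k : ℂ) - 2 * s - 2) / 2 *
              conj ((denom y (I • (1 : Matrix (Fin 2) (Fin 2) ℂ)))⁻¹ * denom (y * W) (I • (1 : Matrix (Fin 2) (Fin 2) ℂ))).trace)) g =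
      archScalarCoeff k s * (archScalarSection k (-s) g *
        ((((k : ℂ) - 2 * (-s) - 2) / 2 - k) *
            ((denom g (I • (1 : Matrix (Fin 2) (Fin 2) ℂ)))⁻¹ * denom (g * W) (I • (1 : Matrix (Fin 2) (Fin 2) ℂ))).trace +
          ((k : ℂ) - 2 * (-s) - 2) / 2 *
            conj ((denom g (I • (1 : Matrix (Fin 2) (Fin 2) ℂ)))⁻¹ * denom (g * W) (I • (1 : Matrix (Fin 2) (Fin 2) ℂ))).trace)) := by
  have h := archIntertwining_lieDeriv_archScalarSection_eq k hs hg (γ := fun t : ℝ => exp (t • W))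
    (γ' := fun t : ℝ => W * exp (t • W)) (exp_zero_smul_eq_one W) (hasDerivAt_exp_smul_entry_at W)
    (fun i j => (continuous_mul_exp_smul_entry W i j).continuousAt) hW
  simpa only [exp_zero_smul_eq_one, Matrix.mul_one] using h

/-- Entries of the affine curve `t ↦ 1 + tW` are differentiable everywhere with derivative `Wᵢⱼ`. [folklore] -/
theorem hasDerivAt_one_add_smul_entry_at (W : Matrix (Fin 2 ⊕ Fin 2) (Fin 2 ⊕ Fin 2) ℂ) (t : ℝ) (i j : Fin 2 ⊕ Fin 2) :
    HasDerivAt (fun t : ℝ => ((1 : Matrix (Fin 2 ⊕ Fin 2) (Fin 2 ⊕ Fin 2) ℂ) + (t : ℂ) • W) i j) (W i j) t := by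
  have h : HasDerivAt (fun t : ℝ => (1 : Matrix (Fin 2 ⊕ Fin 2) (Fin 2 ⊕ Fin 2) ℂ) i j + (t : ℂ) * W i j) (0 + 1 * W i j) t :=
    (hasDerivAt_const t _).add ((Complex.ofRealCLM.hasDerivAt).mul_const (W i j))
  rw [zero_add, one_mul] at h
  exact h.congr_of_eventuallyEq (Eventually.of_forall fun t => by simp [Matrix.add_apply, Matrix.smul_apply])

/-- **THE SWAP LEMMA ALONG THE AFFINE CURVE `1 + tW`** (the ambient convention of K2E5-p16 (g5)'s census: any `W ∈ M₄(ℂ)`).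
[Knapp1986, Ch. VII §3] -/
theorem hasDerivAt_archIntertwining_archScalarSection_mul_one_add_smul (k : ℤ) {s : ℂ} (hs : 1 / 2 < s.re)
    {g : Matrix (Fin 2 ⊕ Fin 2) (Fin 2 ⊕ Fin 2) ℂ} (hg : gᴴ * Matrix.J (Fin 2) ℂ * g = Matrix.J (Fin 2) ℂ)
    (W : Matrix (Fin 2 ⊕ Fin 2) (Fin 2 ⊕ Fin 2) ℂ) :
    HasDerivAt (fun t : ℝ => archIntertwining (archScalarSection k s) (g * (1 + (t : ℂ) • W)))
      (archIntertwining (fun y => archScalarSection k s y *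
          ((((k : ℂ) - 2 * s - 2) / 2 - k) *
              ((denom y (I • (1 : Matrix (Fin 2) (Fin 2) ℂ)))⁻¹ * denom (y * W) (I • (1 : Matrix (Fin 2) (Fin 2) ℂ))).trace +
            ((k : ℂ) - 2 * s - 2) / 2 *
              conj ((denom y (I • (1 : Matrix (Fin 2) (Fin 2) ℂ)))⁻¹ * denom (y * W) (I • (1 : Matrix (Fin 2) (Fin 2) ℂ))).trace)) g) 0 :=
  hasDerivAt_archIntertwining_archScalarSection_mul_curve k hs hg (γ := fun t : ℝ => (1 : Matrix _ _ ℂ) + (t : ℂ) • W)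
    (γ' := fun _ => W) (by simp) (hasDerivAt_one_add_smul_entry_at W) (fun _ _ => continuousAt_const)

end Summit.HodgeConjecture.HodgeConjecture.Cruxes.HLiu418.K2LiuArchIntertwiningLieDerivativeExp

end
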